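import Summits.RiemannHypothesis.RiemannHypothesis.Theses.SpectralTrace
import Literature.NumberTheory.DiophantineGeometry.NamedHypotheses

/-!
# Sketch — crux WindowTracePrime2 (stmt-RiemannHypothesis-11196), crux-ideate round 1, ideator 3 (gen 2)

First lemmas of two idea cards (signatures only; they must ELABORATE, not be proved here):

* `Ideator3g2.SplitA.*` — card `one-signed-split`: the autocorrelation mollifier `K = φ ⋆ φ̃`
  (`K̂ = |φ̂|² ∈ [0,1]`) splits Weil's quadratic form into a ZERO-SIDE part whose every term at an
  on-line zero is non-negative (including the cross terms `K̂(1-K̂)|ĥ|²`) and an ARCH-SIDE part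
  carried by the high-frequency remainder `h - h ⋆ K`, where the digamma weight beats the prime
  terms. Consequence: `WeilPositivityOn (log 3 / 2)` (the positivity half of the crux, = WeilPos
  crux #2) follows from RH up to a finite height plus ONE certified finite-dimensional inequality.
* `Ideator3g2.DesignB.*` — card `critical-line-designs`: one positive bump `b₀` turns the window
  identity into countably many scalar equations ("slots"), the format in which equal-weight
  quadrature / design existence theory (Seymour–Zaslavsky, Bondarenko–Radchenko–Viazovska) is
  stated.
-/

set_option linter.dupNamespace false

noncomputable section

open Complex Set MeasureTheory
open scoped Real

namespace Summit.RiemannHypothesis.RiemannHypothesis.Cruxes.WindowTracePrime2.Ideator3g2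

open Literature.NumberTheory.LFunctions
open Literature.NumberTheory.DiophantineGeometry (RiemannHypothesisUpTo)
open Summit.RiemannHypothesis.RiemannHypothesis.Theses.SpectralTrace

/-- The window-trace predicate of level `A` (verbatim body of the crux at `A = log 3`). -/
def Trace (A : ℝ) (ι : Type) (γ : ι → ℝ) : Prop :=
  ∀ g : ℝ → ℂ, IsWeilTest g → tsupport g ⊆ Set.Icc (-A) A →
    HasSum (fun i => weilMellin g (1 / 2 + (γ i : ℂ) * Complex.I)) (weilFunctional g)

theorem windowTracePrime2_iff : WindowTracePrime2 ↔ ∃ (ι : Type) (γ : ι → ℝ), Trace (Real.log 3) ι γ :=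
  Iff.rfl

/-! ## Card A — the one-signed split -/
namespace SplitA

/-- Admissible mollifier: `K = φ ⋆ φ̃` with `φ` a real, non-negative, even Weil test of unit mass
supported in `[-w, w]`. Then `K̂(γ) = |φ̂(γ)|² ∈ [0, 1]` on the real line (`mollifier_transform`). -/
structure Mollifier (w : ℝ) (φ : ℝ → ℂ) : Prop where
  test : IsWeilTest φ
  real_nonneg : ∀ t, (φ t).im = 0 ∧ 0 ≤ (φ t).re
  even : ∀ t, φ (-t) = φ t
  mass_one : ∫ t, φ t = 1
  supp : tsupport φ ⊆ Set.Icc (-w) w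

/-- The mollifier kernel `K = φ ⋆ φ̃`. -/
def kernel (φ : ℝ → ℂ) : ℝ → ℂ := weilConv φ (weilReflect φ)

/-- Low part `h ⋆ K` and high part `h - h ⋆ K` of a test function. -/
def lowPart (φ h : ℝ → ℂ) : ℝ → ℂ := weilConv h (kernel φ)
def highPart (φ h : ℝ → ℂ) : ℝ → ℂ := h - lowPart φ h

/-- FIRST LEMMA (A1, provable now): on the critical line the mollifier multiplier is real and in
`[0,1]`: `K̂(1/2+iγ) = ‖φ̂(1/2+iγ)‖²` and `‖φ̂(1/2+iγ)‖ ≤ ∫ φ = 1`. -/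
def mollifier_transform : Prop :=
  ∀ (w : ℝ) (φ : ℝ → ℂ), Mollifier w φ → ∀ γ : ℝ,
    weilMellin (kernel φ) (1 / 2 + γ * I) = ((‖weilMellin φ (1 / 2 + γ * I)‖ ^ 2 : ℝ) : ℂ) ∧
      ‖weilMellin φ (1 / 2 + γ * I)‖ ≤ 1

/-- FIRST LEMMA (A2, provable now — the lever): every term of the zero side of
`Q(h) - Q(highPart h)` at an ON-LINE zero is NON-NEGATIVE. With `f = lowPart φ h`, `g = highPart φ h`
and `t = K̂(1/2+iγ) ∈ [0,1]`:
`(f ⋆ f̃)^(1/2+iγ) + (f ⋆ g̃)^(1/2+iγ) + (g ⋆ f̃)^(1/2+iγ) = (t² + 2t(1-t)) · |ĥ(1/2+iγ)|² = (2t - t²)|ĥ|² ≥ 0`. -/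
def cross_terms_one_signed : Prop :=
  ∀ (w : ℝ) (φ : ℝ → ℂ), Mollifier w φ → ∀ (h : ℝ → ℂ), IsWeilTest h → ∀ γ : ℝ,
    let s : ℂ := 1 / 2 + γ * I
    let f := lowPart φ h
    let g := highPart φ h
    let t : ℝ := ‖weilMellin φ s‖ ^ 2
    weilMellin (weilConv f (weilReflect f)) s + weilMellin (weilConv f (weilReflect g)) s +
        weilMellin (weilConv g (weilReflect f)) s =
      (((2 * t - t ^ 2) * ‖weilMellin h s‖ ^ 2 : ℝ) : ℂ) ∧
    0 ≤ (2 * t - t ^ 2) * ‖weilMellin h s‖ ^ 2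

/-- The split identity (bilinearity of `W` over `h = f + g`; provable now):
`Q(h) = W(f⋆f̃) + W(f⋆g̃) + W(g⋆f̃) + Q(g)`. -/
def split_identity : Prop :=
  ∀ (φ h : ℝ → ℂ), IsWeilTest φ → IsWeilTest h →
    weilQuadratic h =
      weilFunctional (weilConv (lowPart φ h) (weilReflect (lowPart φ h))) +
      weilFunctional (weilConv (lowPart φ h) (weilReflect (highPart φ h))) +
      weilFunctional (weilConv (highPart φ h) (weilReflect (lowPart φ h))) +
      weilQuadratic (highPart φ h)

/-- The certified zero-side floor at height `T` with mollifier `φ`: the (finite, non-negative)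
sample sum over the zeros with `|Im ρ| ≤ T`, weight `2K̂ - K̂²`, evaluated on `ĥ`. Under
`RiemannHypothesisUpTo T` every `ρ` here is `1/2 + iγ`. -/
def sampleSum (φ h : ℝ → ℂ) (T : ℝ) : ℝ :=
  ∑ᶠ ρ ∈ weilZeroIndex T,
    (riemannZetaZeroOrder ρ : ℝ) * ((2 * ‖weilMellin φ ρ‖ ^ 2 - ‖weilMellin φ ρ‖ ^ 4) * ‖weilMellin h ρ‖ ^ 2)

/-- The arch-side coercive part carried by the high remainder: digamma weight minus the prime
allowance `cP` (= `2·log 2/√2 + log 3/√3 ≈ 1.62` at half-window `log 3/2`), restricted to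
`|λ| ≥ Λ₀` where it is positive. -/
def archFloor (φ h : ℝ → ℂ) (Λ₀ cP : ℝ) : ℝ :=
  (1 / (2 * π)) * ∫ l in {l : ℝ | Λ₀ ≤ |l|},
    (1 - ‖weilMellin φ (1 / 2 + l * I)‖ ^ 2) ^ 2 * ‖weilMellin h (1 / 2 + l * I)‖ ^ 2 *
      ((Complex.digamma (1 / 4 + l / 2 * I)).re - Real.log π - cP)

/-- CERTIFIED FLOOR (the one finite computation the line needs; interval arithmetic over a
finite-dimensional exhaustion of `L²[-a,a]` plus an analytic high-mode bound):
`sampleSum + archFloor ≥ c ‖h‖₂²` for every test `h` supported in `[-a, a]`. Expected `c ≈ 1e-8`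
(the Connes–Consani float margin at `L = log 3`); kit jobs j012078/j012081 estimate it. -/
def CertifiedFloor (φ : ℝ → ℂ) (T Λ₀ cP a c : ℝ) : Prop :=
  ∀ h : ℝ → ℂ, IsWeilTest h → tsupport h ⊆ Set.Icc (-a) a →
    c * ∫ t, ‖h t‖ ^ 2 ≤ sampleSum φ h T + archFloor φ h Λ₀ cP

/-- OFF-LINE EXPOSURE (provable for an explicit Gevrey bump `φ`, e.g. by the saddle-point bound
for the standard bump): beyond height `T` the mollifier transform is smaller than `δ` on the
whole critical strip, so every zero-side term involving `lowPart` at an uncertified zero is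
negligible. -/
def OffLineExposure (φ : ℝ → ℂ) (T δ : ℝ) : Prop :=
  ∀ s : ℂ, 0 ≤ s.re → s.re ≤ 1 → T < |s.im| → ‖weilMellin (kernel φ) s‖ ≤ δ

/-- THE REDUCTION (the theorem the line `one-signed-split` proves; sizes: split_identity S,
cross_terms M, arch-side bookkeeping for `highPart` M, tail sums M):
RH up to height `T` + small off-line exposure + the certified floor ⇒ first-prime Weil positivity.
The numerical side conditions say the junk (`δ`-terms, low-band leakage `(1-K̂)²` below `Λ₀`,
polar term of the high part) is below the floor `c`. -/
def SplitReduction : Prop :=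
  ∀ (w : ℝ) (φ : ℝ → ℂ) (T δ c : ℝ), Mollifier w φ → 0 < w → w ≤ 1 / 10000 →
    RiemannHypothesisUpTo T → OffLineExposure φ T δ → δ ≤ Real.exp (-100) →
    CertifiedFloor φ T 32 1.62 (Real.log 3 / 2) c → (1e-13 : ℝ) ≤ c →
    WeilPositivityOn (Real.log 3 / 2)

/-- By-product (bottom rigidity of EVERY witness; Disproof-side target): the near-kernel vector of
Weil's form at half-window `log 3 / 2` pins the first atom of any witness of the crux to the
first zeta ordinate and forbids atoms below it. Constants are what the certified float suggests;
a refuter sharpens them. -/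
def BottomPinned : Prop :=
  ∀ (ι : Type) (γ : ι → ℝ), Trace (Real.log 3) ι γ →
    (∀ i, |γ i| ≤ 13 → False) ∧ ∃ i, |(|γ i|) - 14.134725| ≤ 0.2

end SplitA

/-! ## Card B — designs on the critical line -/
namespace DesignB

/-- Slot test functions: one bump `b₀` modulated to the slot frequencies `πk/L`. -/
def slotTest (b₀ : ℝ → ℂ) (L : ℝ) (k : ℤ) : ℝ → ℂ :=
  fun t => b₀ t * Complex.exp ((π * k / L : ℝ) * t * I)

/-- FIRST LEMMA (B1, → provable now; ← is the density statement the card needs, size M):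
with `b₀` a Weil test, `b₀ > 0` on `(-L, L)` and supported in `[-L, L]`, the window identity of
level `L` is equivalent to the countable system of SLOT EQUATIONS
`Σ_i b̂₀(γ_i + πk/L) = W(slotTest b₀ L k)`, `k ∈ ℤ`, for locally finite families. -/
def slot_equations_iff : Prop :=
  ∀ (L : ℝ) (b₀ : ℝ → ℂ), 0 < L → IsWeilTest b₀ → tsupport b₀ ⊆ Set.Icc (-L) L →
    (∀ t ∈ Set.Ioo (-L) L, 0 < (b₀ t).re ∧ (b₀ t).im = 0) →
    ∀ (ι : Type) (γ : ι → ℝ), (∀ R : ℝ, {i | |γ i| ≤ R}.Finite) →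
      (Trace L ι γ ↔ ∀ k : ℤ,
        HasSum (fun i => weilMellin (slotTest b₀ L k) (1 / 2 + (γ i : ℂ) * I))
          (weilFunctional (slotTest b₀ L k)))

/-- The smooth spectral density of the Weil distribution seen through the window `(-log 3, log 3)`
(arch density + prime-2 ripple; the polar term is handled as a separate explicit functional):
`ρ_W(λ) = (1/2π)(Re ψ(1/4 + iλ/2) - log π) - (log 2/(π√2)) cos(λ log 2)`. -/
def rhoW (l : ℝ) : ℝ :=
  (1 / (2 * π)) * ((Complex.digamma (1 / 4 + l / 2 * I)).re - Real.log π) -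
    Real.log 2 / (π * Real.sqrt 2) * Real.cos (l * Real.log 2)

/-- BLOCK DESIGN (B2, the nonperturbative existence statement of the card, finite-dimensional;
Brouwer-degree / BRV lemma): in the slack regime every height block `[T, T + H]` carries a
configuration of `N` UNIT atoms, one per unit-mass quantile cell of `ρ_W`, that matches the slot
functionals of all slots INTERIOR to the block exactly, for any prescribed interior targets within
`ε` of the `ρ_W`-moments (the freedom used to absorb the leakage of neighbouring blocks). -/
def BlockDesign (L : ℝ) (b₀ : ℝ → ℂ) : Prop :=
  ∃ T₀ ε₀ : ℝ, 0 < ε₀ ∧ ∀ T H : ℝ, T₀ ≤ T → 100 ≤ H →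
    ∀ target : ℤ → ℂ,
      (∀ k : ℤ, T + 10 ≤ π * k / L → π * k / L ≤ T + H - 10 →
        ‖target k - ∫ l in Set.Icc T (T + H), weilMellin b₀ (1 / 2 + ((l : ℂ) - π * k / L) * I) * rhoW l‖ ≤ ε₀) →
      ∃ (N : ℕ) (x : Fin N → ℝ), (∀ j, x j ∈ Set.Icc T (T + H)) ∧ Function.Injective x ∧
        ∀ k : ℤ, T + 10 ≤ π * k / L → π * k / L ≤ T + H - 10 →
          ∑ j, weilMellin b₀ (1 / 2 + ((x j : ℂ) - π * k / L) * I) = target k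

end DesignB

end Summit.RiemannHypothesis.RiemannHypothesis.Cruxes.WindowTracePrime2.Ideator3g2
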